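import Literature.Topology.FourManifolds.UnitLemma
import Literature.Topology.FourManifolds.ReparamTools
import Literature.Topology.FourManifolds.ExitHost
import HarnessLib

/-!
# The chord host: the reflected flip knot reparametrised by the clock of a third datum

Topic `Literature/Topology/FourManifolds` (trunk T-4MAN). Fact seat
`provefact-Literature.Topology.FourManifolds.Knot.IsConnectedSum.isIsotopic` (Schubert's theorem),
geometric heart for rail knots, first assembly step. Let `(b₁, b₂)` be a flip pair at the scales of
`FlipWall.lean` and `b` a third datum at a uniform shrink scale with its straight clock
`r = clockFn` (`ExitHost.lean`) on the **straight parameters** `[parLo (1/4), parHi (1/4)]`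
(clocks `[-1, 1]`, covering the whole content of `b`). The **chord host** is the reflected flip knot `R ∘ flipKnot 1` of `(b₁, b₂)`
reparametrised over the circle of `b` by a lift (`ReparamTools.lean`) which on the straight
parameters of `b` runs along the straight chord of `b₂` (`flipSpikedC_one_chord`) with the clock of
`b`: `chordHost (circlePt u) = ψ⁻¹ (o' + r u • d')`, `o' = chordLine 2`,
`d' = (2/9) (railLoPsi (11/4) - railLoPsi (5/4))`. It is isotopic to `R ∘ B₁`
(`UnitLemma.isIsotopic_flipKnot_one_B`, `Knot.isIsotopic_of_range_eq_holds`).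

Everything is proved; no named facts are introduced.

## References

* M. W. Hirsch, *Differential Topology*, Springer GTM 33 (1976), Ch. 8 §1. [HirschDT1976]
-/

open scoped Manifold ContDiff Topology Real
open Function Set Metric Filter

noncomputable section

namespace Literature.Topology.FourManifolds

/-- Local notation: `𝔼 n` is the model Euclidean space `EuclideanSpace ℝ (Fin n)`. -/
local notation "𝔼 " n:arg => EuclideanSpace ℝ (Fin n)

/-- Local notation: `𝕊 n` is the unit sphere in `EuclideanSpace ℝ (Fin (n + 1))`. -/
local notation "𝕊 " n:arg => (Metric.sphere (0 : EuclideanSpace ℝ (Fin (n + 1))) 1)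

attribute [local instance] fact_finrank_euclideanSpace_succ

open KnotsInBall

/-! ### The knot of the curve of a knot -/

/-- The curve of a knot identifies only parameters differing by integers. [folklore] -/
theorem Knot.simple_curve (K : Knot) : ∀ s t, Knot.curve K s = Knot.curve K t → ∃ m : ℤ, t - s = m := by
  intro s t h
  obtain ⟨m, hm⟩ := K.curve_eq_curve_iff.1 h
  exact ⟨-m, by push_cast; linarith⟩

/-- **The knot of the curve of a knot is the knot.** [folklore] -/
theorem Knot.toKnot_curve (K : Knot) : K.isRegularLoop_curve.toKnot K.simple_curve = K := by
  apply DFunLike.coe_injective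
  funext x
  obtain ⟨t, rfl⟩ := exists_circlePt_eq x
  apply Subtype.ext
  rw [K.isRegularLoop_curve.coe_toKnot_circlePt, Knot.curve_apply]

namespace BandData

/-! ### Levels and marks -/

/-- The level `1/8` lies in `[-7, 7]`. [folklore] -/
theorem eighth_mem7 : (1 / 8 : ℝ) ∈ Icc (-7 : ℝ) 7 := ⟨by norm_num, by norm_num⟩

/-- The level `1/4` lies in `[-7, 7]`. [folklore] -/
theorem quarter_mem7 : (1 / 4 : ℝ) ∈ Icc (-7 : ℝ) 7 := ⟨by norm_num, by norm_num⟩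

/-- The level `1` lies in `[-7, 7]`. [folklore] -/
theorem one_mem7 : (1 : ℝ) ∈ Icc (-7 : ℝ) 7 := ⟨by norm_num, by norm_num⟩

/-- The spike scalar left of `7/16` is the affine stub clock `1 - (4/3)(α - 1/4)`. [folklore] -/
theorem spikeScalar_of_le_seven_sixteenths (c : ℝ) {α : ℝ} (hα : α ≤ 7 / 16) : spikeScalar c α = 1 - 4 / 3 * (α - 1 / 4) := by
  rw [spikeScalar, spikeWin_eq_zero hα]; ring

section Base

variable {A B K : Knot} (b : BandData A B K ∅)
  {hcross : b.band ⁻¹' sphereEquator 2 ∩ squareNhd b.δ = {x ∈ squareNhd b.δ | x 0 = 2⁻¹}}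
  {ε r A' κ lam₀ : ℝ} (HU : b.ShrinkScaleU hcross ε r A' κ) (hl : lam₀ ∈ Ioc (0 : ℝ) 1) (hl2 : lam₀ ≤ 1 / 2)

/-- **The first straight parameter** of `b`: the lower-core parameter of level `1/4` (stub base,
clock `-1`). [folklore] -/
def strLo : ℝ := b.parLo HU.cone.spike.κ_pos HU.cone.spike.seven_le_gapLo quarter_mem7

/-- **The last straight parameter** of `b` used by the chord lift: the upper-core parameter of
level `1/4` (clock `1`; beyond the end `winHi` of the straight host segment, so that the whole
upper content of `b` is covered). [folklore] -/
def strHi : ℝ := b.parHi HU.cone.spike.κ_pos HU.cone.spike.seven_le_gapHi quarter_mem7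

/-- The left end of the clock zone: level `1/8` on the lower core. [folklore] -/
def zoneLo : ℝ := b.parLo HU.cone.spike.κ_pos HU.cone.spike.seven_le_gapLo eighth_mem7

/-- The right end of the clock zone: level `1/8` on the upper core. [folklore] -/
def zoneHi : ℝ := b.parHi HU.cone.spike.κ_pos HU.cone.spike.seven_le_gapHi eighth_mem7

include hl in
/-- **Basic order of the straight marks and the clock zone.** [folklore] -/
theorem str_marks : b.zoneLo HU < b.strLo HU ∧ b.strLo HU < b.winLo HU hl ∧ b.winHi HU hl < b.strHi HU ∧
    b.strHi HU < b.zoneHi HU ∧ b.tcLo - b.epsLo / 8 ≤ b.zoneLo HU ∧ b.zoneHi HU ≤ b.tcHi + b.epsHi / 8 := by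
  have h := HU.cone.spike
  have hκ := h.κ_pos
  have hc := cOne_mem hl
  obtain ⟨hwc, hwv⟩ := b.clockLo_spec HU hl half_mem_Icc
  obtain ⟨hWc, hWv⟩ := b.clockHi_spec HU hl half_mem_Icc
  have hw' : b.winLo HU hl ∈ Icc (b.tcLo - b.epsLo / 8) (b.tcLo + b.epsLo / 8) := b.winLo_mem_core HU hl
  have hW' : b.winHi HU hl ∈ Icc (b.tcHi - b.epsHi / 8) (b.tcHi + b.epsHi / 8) := b.winHi_mem_core HU hl
  refine ⟨b.parLo_lt_parLo hκ h.seven_le_gapLo eighth_mem7 quarter_mem7 (by norm_num), ?_, ?_,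
    b.parHi_lt_parHi hκ h.seven_le_gapHi eighth_mem7 quarter_mem7 (by norm_num),
    (b.parLo_mem_core hκ h.seven_le_gapLo eighth_mem7).1, (b.parHi_mem_core hκ h.seven_le_gapHi eighth_mem7).2⟩
  · -- `αLo (winLo) > 1/4` since `psiLo (winLo) = 1/2 < 1 = spikeScalar (1/4)`
    rw [strLo, ← b.lt_alphaLo_iff' hκ h.seven_le_gapLo quarter_mem7 hw']
    by_contra hle
    push Not at hle
    have hanti := strictAntiOn_spikeScalar hc
    have h1 : spikeScalar (1 * (1 - lam₀)) (1 / 4) ≤ spikeScalar (1 * (1 - lam₀)) (b.alphaLo κ (b.winLo HU hl)) :=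
      hanti.antitoneOn (show b.alphaLo κ (b.winLo HU hl) ∈ Iio (1:ℝ) by simp only [mem_Iio]; linarith)
        (show (1/4:ℝ) ∈ Iio (1:ℝ) by norm_num) hle
    rw [spikeScalar_of_le_seven_sixteenths (1 * (1 - lam₀)) (α := 1 / 4) (by norm_num)] at h1
    have h2 : b.psiLo κ lam₀ (b.winLo HU hl) = 1 / 2 := hwv
    simp only [psiLo] at h2
    linarith
  · rw [strHi, ← b.lt_alphaHi_iff' hκ h.seven_le_gapHi quarter_mem7 hW']
    by_contra hle
    push Not at hle
    have hanti := strictAntiOn_spikeScalar hc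
    have h1 : spikeScalar (1 * (1 - lam₀)) (1 / 4) ≤ spikeScalar (1 * (1 - lam₀)) (b.alphaHi κ (b.winHi HU hl)) :=
      hanti.antitoneOn (show b.alphaHi κ (b.winHi HU hl) ∈ Iio (1:ℝ) by simp only [mem_Iio]; linarith)
        (show (1/4:ℝ) ∈ Iio (1:ℝ) by norm_num) hle
    rw [spikeScalar_of_le_seven_sixteenths (1 * (1 - lam₀)) (α := 1 / 4) (by norm_num)] at h1
    have h2 : b.psiHi κ lam₀ (b.winHi HU hl) = 1 / 2 := hWv
    simp only [psiHi] at h2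
    linarith

include hl in
/-- **The clock on the clock zone**: values in `(-7/6, 7/6)` and positive derivative, on
`(zoneLo, zoneHi)`. [folklore] -/
theorem clockFn_zone {u : ℝ} (hu : u ∈ Ioo (b.zoneLo HU) (b.zoneHi HU)) :
    b.clockFn HU hl hl2 u ∈ Ioo (-(7 / 6) : ℝ) (7 / 6) ∧ 0 < deriv (b.clockFn HU hl hl2) u := by
  have h := HU.cone.spike
  have hκ := h.κ_pos
  have hc := cOne_mem hl
  obtain ⟨m1, m2, m3, m3', m4, m5⟩ := b.str_marks HU hl
  have hwc := b.winLo_mem_core HU hl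
  have hWc := b.winHi_mem_core HU hl
  have o1 := b.winLo_lt_collarLo HU hl hl2
  have o2 := b.collarHi_lt_winHi HU hl hl2
  have o3 := b.collarLo_lt_collarHi HU hl hl2
  obtain ⟨-, hwv⟩ := b.clockLo_spec HU hl half_mem_Icc
  obtain ⟨-, hWv⟩ := b.clockHi_spec HU hl half_mem_Icc
  have hanti := strictAntiOn_spikeScalar hc
  -- clock values: monotone, between the zone ends
  rcases lt_or_ge u (b.winLo HU hl) with h1 | h1
  · -- lower ray/stub: `clockFn = -psiLo`, `αLo ∈ (1/8, αLo winLo)`, `αLo winLo < 1`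
    have hcore : u ∈ Icc (b.tcLo - b.epsLo / 8) (b.tcLo + b.epsLo / 8) := ⟨by linarith [hu.1], by linarith [hwc.2]⟩
    have hα1 : 1 / 8 < b.alphaLo κ u := (b.lt_alphaLo_iff' hκ h.seven_le_gapLo eighth_mem7 hcore).2 hu.1
    have hαw : b.alphaLo κ (b.winLo HU hl) < 1 := by
      by_contra hle; push Not at hle
      have := spikeScalar_nonpos hc hle
      have h2 : b.psiLo κ lam₀ (b.winLo HU hl) = 1 / 2 := hwv
      simp only [psiLo] at h2; linarith
    have hw1 : b.winLo HU hl < b.parLo hκ h.seven_le_gapLo one_mem7 := (b.alphaLo_lt_iff' hκ h.seven_le_gapLo one_mem7 hwc).1 hαw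
    have hαu : b.alphaLo κ u < 1 := (b.alphaLo_lt_iff' hκ h.seven_le_gapLo one_mem7 hcore).2 (by linarith)
    have hev : b.clockFn HU hl hl2 =ᶠ[𝓝 u] fun u ↦ -b.psiLo κ lam₀ u := by
      filter_upwards [Iio_mem_nhds (show u < b.collarLo HU hl by linarith)] with s hs using b.clockFn_of_le_collarLo HU hl hl2 hs.le
    obtain ⟨D, hD, hDd⟩ := b.hasDerivAt_psiLo_neg hl hκ hcore hαu
    have hDn : HasDerivAt (fun u ↦ -b.psiLo κ lam₀ u) (-D) u := hDd.neg
    refine ⟨?_, by rw [hev.deriv_eq, hDn.deriv]; linarith⟩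
    rw [hev.self_of_nhds]
    have hψ : b.psiLo κ lam₀ u < 7 / 6 := by
      have := hanti (show (1/8:ℝ) ∈ Iio (1:ℝ) by norm_num) (show b.alphaLo κ u ∈ Iio (1:ℝ) from hαu) hα1
      rw [spikeScalar_of_le_seven_sixteenths (1 * (1 - lam₀)) (α := 1 / 8) (by norm_num)] at this
      simp only [psiLo]; linarith
    have hψ0 : 0 < b.psiLo κ lam₀ u := spikeScalar_pos hc hαu
    exact ⟨by linarith, by linarith⟩
  rcases le_or_gt u (b.winHi HU hl) with h2 | h2
  · -- window
    have hmono := b.strictMonoOn_clockFn HU hl hl2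
    have hv1 := b.clockFn_winLo HU hl hl2
    have hv2 := b.clockFn_winHi HU hl hl2
    have hle1 : b.clockFn HU hl hl2 (b.winLo HU hl) ≤ b.clockFn HU hl hl2 u := hmono.monotoneOn ⟨le_rfl, by linarith⟩ ⟨h1, h2⟩ h1
    have hle2 : b.clockFn HU hl hl2 u ≤ b.clockFn HU hl hl2 (b.winHi HU hl) := hmono.monotoneOn ⟨h1, h2⟩ ⟨by linarith, le_rfl⟩ h2
    exact ⟨⟨by linarith, by linarith⟩, b.deriv_clockFn_pos HU hl hl2 ⟨h1, h2⟩⟩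
  · -- upper bent ray: `clockFn = psiHi`
    have hcore : u ∈ Icc (b.tcHi - b.epsHi / 8) (b.tcHi + b.epsHi / 8) := ⟨by linarith [hWc.1], by linarith [hu.2]⟩
    have hα1 : 1 / 8 < b.alphaHi κ u := (b.lt_alphaHi_iff' hκ h.seven_le_gapHi eighth_mem7 hcore).2 hu.2
    have hαw : b.alphaHi κ (b.winHi HU hl) < 1 := by
      by_contra hle; push Not at hle
      have := spikeScalar_nonpos hc hle
      have h3 : b.psiHi κ lam₀ (b.winHi HU hl) = 1 / 2 := hWv
      simp only [psiHi] at h3; linarith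
    have hw1 : b.parHi hκ h.seven_le_gapHi one_mem7 < b.winHi HU hl := (b.alphaHi_lt_iff' hκ h.seven_le_gapHi one_mem7 hWc).1 hαw
    have hαu : b.alphaHi κ u < 1 := (b.alphaHi_lt_iff' hκ h.seven_le_gapHi one_mem7 hcore).2 (by linarith)
    have hev : b.clockFn HU hl hl2 =ᶠ[𝓝 u] b.psiHi κ lam₀ := by
      filter_upwards [Ioi_mem_nhds (show b.collarHi HU hl < u by linarith)] with s hs using b.clockFn_of_collarHi_le HU hl hl2 hs.le
    obtain ⟨D, hD, hDd⟩ := b.hasDerivAt_psiHi_pos hl hκ hcore hαu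
    refine ⟨?_, by rw [hev.deriv_eq, hDd.deriv]; exact hD⟩
    rw [hev.self_of_nhds]
    have hψ : b.psiHi κ lam₀ u < 7 / 6 := by
      have := hanti (show (1/8:ℝ) ∈ Iio (1:ℝ) by norm_num) (show b.alphaHi κ u ∈ Iio (1:ℝ) from hαu) hα1
      rw [spikeScalar_of_le_seven_sixteenths (1 * (1 - lam₀)) (α := 1 / 8) (by norm_num)] at this
      simp only [psiHi]; linarith
    have hψ0 : 0 < b.psiHi κ lam₀ u := spikeScalar_pos hc hαu
    exact ⟨by linarith, by linarith⟩

include hl in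
/-- **The clock on the straight parameters** `[strLo, strHi]` takes values in `[-1, 1]`, with `-1`
at `strLo`, `1/2` at `winHi` and `1` at `strHi`. [folklore] -/
theorem clockFn_str {u : ℝ} (hu : u ∈ Icc (b.strLo HU) (b.strHi HU)) :
    b.clockFn HU hl hl2 u ∈ Icc (-1 : ℝ) 1 := by
  have h := HU.cone.spike
  have hκ := h.κ_pos
  obtain ⟨m1, m2, m3, m3', m4, m5⟩ := b.str_marks HU hl
  have hww : b.winLo HU hl < b.winHi HU hl := by
    linarith [b.winLo_lt_collarLo HU hl hl2, b.collarLo_lt_collarHi HU hl hl2, b.collarHi_lt_winHi HU hl hl2]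
  have hmono : StrictMonoOn (b.clockFn HU hl hl2) (Icc (b.strLo HU) (b.strHi HU)) :=
    strictMonoOn_of_deriv_pos (convex_Icc _ _) (b.contDiff_clockFn HU hl hl2).continuous.continuousOn fun t ht ↦
      (b.clockFn_zone HU hl hl2 ⟨by rw [interior_Icc] at ht; linarith [ht.1], by rw [interior_Icc] at ht; linarith [ht.2]⟩).2
  have hv1 : b.clockFn HU hl hl2 (b.strLo HU) = -1 := by
    rw [b.clockFn_of_le_collarLo HU hl hl2 (by linarith [b.winLo_lt_collarLo HU hl hl2]), psiLo, strLo,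
      b.alphaLo_parLo hκ h.seven_le_gapLo quarter_mem7, spikeScalar_of_le_seven_sixteenths (1 * (1 - lam₀)) (α := 1 / 4) (by norm_num)]
    norm_num
  have hv2 : b.clockFn HU hl hl2 (b.strHi HU) = 1 := by
    rw [b.clockFn_of_collarHi_le HU hl hl2 (by linarith [b.collarHi_lt_winHi HU hl hl2]), psiHi, strHi,
      b.alphaHi_parHi hκ h.seven_le_gapHi quarter_mem7, spikeScalar_of_le_seven_sixteenths (1 * (1 - lam₀)) (α := 1 / 4) (by norm_num)]
    norm_num
  have h1 := hmono.monotoneOn ⟨le_rfl, by linarith⟩ hu hu.1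
  have h2 := hmono.monotoneOn hu ⟨by linarith, le_rfl⟩ hu.2
  rw [hv1] at h1; rw [hv2] at h2
  exact ⟨h1, h2⟩

/-- **The clock values at the straight marks**: `-1` at `strLo`, `1` at `strHi`. [folklore] -/
theorem clockFn_strLo_strHi : b.clockFn HU hl hl2 (b.strLo HU) = -1 ∧ b.clockFn HU hl hl2 (b.strHi HU) = 1 := by
  have h := HU.cone.spike
  have hκ := h.κ_pos
  obtain ⟨m1, m2, m3, m3', m4, m5⟩ := b.str_marks HU hl
  constructor
  · rw [b.clockFn_of_le_collarLo HU hl hl2 (by linarith [b.winLo_lt_collarLo HU hl hl2]), psiLo, strLo,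
      b.alphaLo_parLo hκ h.seven_le_gapLo quarter_mem7, spikeScalar_of_le_seven_sixteenths (1 * (1 - lam₀)) (α := 1 / 4) (by norm_num)]
    norm_num
  · rw [b.clockFn_of_collarHi_le HU hl hl2 (by linarith [b.collarHi_lt_winHi HU hl hl2]), psiHi, strHi,
      b.alphaHi_parHi hκ h.seven_le_gapHi quarter_mem7, spikeScalar_of_le_seven_sixteenths (1 * (1 - lam₀)) (α := 1 / 4) (by norm_num)]
    norm_num

/-- **The clock is strictly increasing on the straight parameters.** [folklore] -/
theorem strictMonoOn_clockFn_str : StrictMonoOn (b.clockFn HU hl hl2) (Icc (b.strLo HU) (b.strHi HU)) := by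
  obtain ⟨m1, m2, m3, m3', m4, m5⟩ := b.str_marks HU hl
  exact strictMonoOn_of_deriv_pos (convex_Icc _ _) (b.contDiff_clockFn HU hl hl2).continuous.continuousOn fun t ht ↦
    (b.clockFn_zone HU hl hl2 ⟨by rw [interior_Icc] at ht; linarith [ht.1], by rw [interior_Icc] at ht; linarith [ht.2]⟩).2

end Base

/-! ### The chord host -/

section Chord

variable {A B K : Knot} (b : BandData A B K ∅)
  {hcross : b.band ⁻¹' sphereEquator 2 ∩ squareNhd b.δ = {x ∈ squareNhd b.δ | x 0 = 2⁻¹}}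
  {ε r A' κ lam₀ : ℝ} (HU : b.ShrinkScaleU hcross ε r A' κ) (hl : lam₀ ∈ Ioc (0 : ℝ) 1) (hl2 : lam₀ ≤ 1 / 2)
  {A₁ B₁ K₁ : Knot} {b₁ : BandData A₁ B₁ K₁ ∅} {A₂ B₂ K₂ : Knot} {b₂ : BandData A₂ B₂ K₂ ∅}
  {hcross₁ : b₁.band ⁻¹' sphereEquator 2 ∩ squareNhd b₁.δ = {x ∈ squareNhd b₁.δ | x 0 = 2⁻¹}}
  {hcross₂ : b₂.band ⁻¹' sphereEquator 2 ∩ squareNhd b₂.δ = {x ∈ squareNhd b₂.δ | x 0 = 2⁻¹}}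
  {ε₁ r₁ A₁' κ₁ ε₂ r₂ : ℝ} (HU₁ : b₁.ShrinkScaleU hcross₁ ε₁ r₁ A₁' κ₁) (h₂ : b₂.ArcScale hcross₂ ε₂ r₂ κ₁)
  (hP : IsFlipPair b₁ b₂) (hT : PairScale hP hcross₂ hcross₁ κ₁)
  {ε₁' r₁' : ℝ} (hf₁ : b₁.IsFlat hcross₁ ε₁' r₁') (hε₁ : ε₁' ≤ 1 / 100) (hr₁ : 5 * κ₁ < r₁')
  (hA₁ : A₁.InNorth) (hB₁ : B₁.InSouth) (hAB₁ : Disjoint (range A₁) (range B₁)) (hB₂ : B₂.InSouth)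

/-- **The reflected flip knot** `R ∘ flipKnot 1` of the pair `(b₁, b₂)`. [folklore] -/
def flipR : Knot :=
  (flipKnot h₂ hT HU₁.cone hf₁ hε₁ hr₁ hA₁ hB₁ hAB₁ hB₂ (u := 1) ⟨zero_le_one, le_rfl⟩).map (reflectLastDiffeo 3)

/-- **The reflected flip knot is isotopic to `R ∘ B₁`.** [cite: HirschDT1976, Ch. 8 §1, Thm. 1.3] -/
theorem isIsotopic_flipR (hBA : B₁ = A₂.map (reflectLastDiffeo 3)) :
    (flipR HU₁ h₂ hP hT hf₁ hε₁ hr₁ hA₁ hB₁ hAB₁ hB₂).IsIsotopic (B₁.map (reflectLastDiffeo 3)) :=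
  (isIsotopic_flipKnot_one_B HU₁ h₂ hP hBA hT hf₁ hε₁ hr₁ hA₁ hB₁ hAB₁ hB₂).map_congr _

/-- **The chord level** read from the clock of `b`: `2 + r/3 ∈ [5/3, 13/6]` on the straight
parameters. [folklore] -/
def chordLev (u : ℝ) : ℝ := 2 + b.clockFn HU hl hl2 u / 3

/-- **The chord parameter**: the upper-core parameter of `b₁` at level `-(2 + r/3)` (the scale
hypothesis of `b₁` only fixes `b₁` and `κ₁`). [folklore] -/
def chordPar (_HU₁ : b₁.ShrinkScaleU hcross₁ ε₁ r₁ A₁' κ₁) (u : ℝ) : ℝ := levHi b₁ κ₁ (-b.chordLev HU hl hl2 u)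

/-- The centre of the chord: `chordLine 2`. [folklore] -/
def chordO (_ : b₂.ArcScale hcross₂ ε₂ r₂ κ₁) : 𝔼 3 := b₂.chordLine κ₁ 2

/-- The direction of the chord (scaled to the clock of `b`): `(2/9) (railLoPsi (11/4) - railLoPsi (5/4))`.
[folklore] -/
def chordD (_ : b₂.ArcScale hcross₂ ε₂ r₂ κ₁) : 𝔼 3 := (2 / 9 : ℝ) • (b₂.railLoPsi κ₁ (11 / 4) - b₂.railLoPsi κ₁ (5 / 4))

/-- **The chord line at the chord level is affine in the clock**: `chordLine (2 + c/3) = o' + c d'`.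
[folklore] -/
theorem chordLine_chordLev (c : ℝ) : b₂.chordLine κ₁ (2 + c / 3) = chordO h₂ + c • chordD h₂ := by
  simp only [chordLine, chordO, chordD, smul_smul]
  rw [show (2 + c / 3 - 5 / 4) * (2 / 3) = (2 - 5 / 4) * (2 / 3) + c * (2 / 9) by ring, add_smul, add_assoc]

include hl in
/-- **The chord parameter on the clock zone**: `C^∞` with positive derivative, in the upper core of
`b₁`, at level `αHi₁ = -(2 + r/3)`. [folklore] -/
theorem chordPar_zone {u : ℝ} (hu : u ∈ Ioo (b.zoneLo HU) (b.zoneHi HU)) :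
    (ContDiffAt ℝ ∞ (b.chordPar HU hl hl2 HU₁) u ∧ 0 < deriv (b.chordPar HU hl hl2 HU₁) u) ∧
    b.chordPar HU hl hl2 HU₁ u ∈ Icc (b₁.tcHi - b₁.epsHi / 8) (b₁.tcHi + b₁.epsHi / 8) ∧
    b₁.alphaHi κ₁ (b.chordPar HU hl hl2 HU₁ u) = -b.chordLev HU hl hl2 u := by
  have h1 := HU₁.cone.spike
  have hκ₁ := h1.κ_pos
  obtain ⟨hcv, hcd⟩ := b.clockFn_zone HU hl hl2 hu
  have hlev : -b.chordLev HU hl hl2 u ∈ Ioo (-7 : ℝ) 7 := by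
    simp only [chordLev]; constructor <;> linarith [hcv.1, hcv.2]
  have hlev' : -b.chordLev HU hl hl2 u ∈ Icc (-7 : ℝ) 7 := Ioo_subset_Icc_self hlev
  obtain ⟨hs, hd⟩ := contDiffAt_levHi hκ₁ b₁ h1.seven_le_gapHi hlev
  have hC : HasDerivAt (b.chordLev HU hl hl2) (deriv (b.clockFn HU hl hl2) u / 3) u := by
    have := ((((b.contDiff_clockFn HU hl hl2).differentiable (by simp)) u).hasDerivAt.div_const 3).const_add 2
    exact this
  have hcomp : HasDerivAt (b.chordPar HU hl hl2 HU₁) (deriv (levHi b₁ κ₁) (-b.chordLev HU hl hl2 u) * -(deriv (b.clockFn HU hl hl2) u / 3)) u :=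
    HasDerivAt.comp (h₂ := levHi b₁ κ₁) (h := fun u ↦ -b.chordLev HU hl hl2 u) u ((hs.differentiableAt (by simp)).hasDerivAt) hC.neg
  refine ⟨⟨hs.comp u ((contDiff_const.add ((b.contDiff_clockFn HU hl hl2).div_const 3)).neg.contDiffAt), ?_⟩, ?_, ?_⟩
  · rw [hcomp.deriv]; exact mul_pos_of_neg_of_neg hd (by linarith)
  · rw [chordPar, levHi_eq_parHi hκ₁ b₁ h1.seven_le_gapHi hlev']; exact b₁.parHi_mem_core hκ₁ h1.seven_le_gapHi hlev'
  · rw [chordPar, levHi_eq_parHi hκ₁ b₁ h1.seven_le_gapHi hlev']; exact b₁.alphaHi_parHi hκ₁ h1.seven_le_gapHi hlev'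

include hl in
/-- **Existence of the chord lift**: a lift equal to the chord parameter on the straight parameters
of `b`. [folklore] -/
theorem exists_chordLift : ∃ ĝ : ℝ → ℝ, IsLift ĝ ∧ ∀ u ∈ Icc (b.strLo HU) (b.strHi HU), ĝ u = b.chordPar HU hl hl2 HU₁ u := by
  obtain ⟨m1, m2, m3, m3', m4, m5⟩ := b.str_marks HU hl
  have hcm := b.core_marks
  have hε := b.epsLo_bounds.1
  have hε' := b.epsHi_bounds.1
  have hε₁ := b₁.epsHi_bounds
  have hww : b.winLo HU hl < b.winHi HU hl := by
    linarith [b.winLo_lt_collarLo HU hl hl2, b.collarLo_lt_collarHi HU hl hl2, b.collarHi_lt_winHi HU hl hl2]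
  -- the margin
  set η := min (min (b.strLo HU - b.zoneLo HU) (b.zoneHi HU - b.strHi HU)) (1 - (b.strHi HU - b.strLo HU)) / 16 with hη
  have hgap : b.strHi HU - b.strLo HU < 1 := by linarith
  have hηpos : 0 < η := by rw [hη]; exact div_pos (lt_min (lt_min (by linarith) (by linarith)) (by linarith)) (by norm_num)
  have hη1 : η ≤ (b.strLo HU - b.zoneLo HU) / 16 := by
    rw [hη]; exact div_le_div_of_nonneg_right ((min_le_left _ _).trans (min_le_left _ _)) (by norm_num)
  have hη2 : η ≤ (b.zoneHi HU - b.strHi HU) / 16 := by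
    rw [hη]; exact div_le_div_of_nonneg_right ((min_le_left _ _).trans (min_le_right _ _)) (by norm_num)
  have hη3 : η ≤ (1 - (b.strHi HU - b.strLo HU)) / 16 := by
    rw [hη]; exact div_le_div_of_nonneg_right (min_le_right _ _) (by norm_num)
  have hzone : ∀ t ∈ Ioo (b.strLo HU - 2 * η) (b.strHi HU + 2 * η), t ∈ Ioo (b.zoneLo HU) (b.zoneHi HU) := fun t ht ↦
    ⟨by linarith [ht.1], by linarith [ht.2]⟩
  refine exists_periodic_lift hηpos (by linarith) (by linarith) (fun t ht ↦ (b.chordPar_zone HU hl hl2 HU₁ (hzone t ht)).1) ?_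
  -- the rise is `< 1`: both values lie in the upper core of `b₁`, of length `epsHi₁/4 < 1`
  have hv1 := (b.chordPar_zone HU hl hl2 HU₁ (hzone (b.strHi HU + η) ⟨by linarith, by linarith⟩)).2.1
  have hv2 := (b.chordPar_zone HU hl hl2 HU₁ (hzone (b.strLo HU - η) ⟨by linarith, by linarith⟩)).2.1
  have hlen : b₁.epsHi < 1 := by
    have := b₁.marks_lt; have := b₁.thetaA_window; linarith [hε₁.2.1]
  linarith [hv1.2, hv2.1]

/-- **The chord lift.** [folklore] -/
def chordLift : ℝ → ℝ := (b.exists_chordLift HU hl hl2 HU₁).choose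

/-- The chord lift is a lift. [folklore] -/
theorem isLift_chordLift : IsLift (b.chordLift HU hl hl2 HU₁) := (b.exists_chordLift HU hl hl2 HU₁).choose_spec.1

/-- The chord lift on the straight parameters. [folklore] -/
theorem chordLift_of_mem {u : ℝ} (hu : u ∈ Icc (b.strLo HU) (b.strHi HU)) :
    b.chordLift HU hl hl2 HU₁ u = b.chordPar HU hl hl2 HU₁ u :=
  (b.exists_chordLift HU hl hl2 HU₁).choose_spec.2 u hu

/-- **The chord host loop**: the curve of the reflected flip knot through the chord lift. [folklore] -/
def chordHostLoop : ℝ → 𝔼 4 :=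
  Knot.curve (flipR HU₁ h₂ hP hT hf₁ hε₁ hr₁ hA₁ hB₁ hAB₁ hB₂) ∘ b.chordLift HU hl hl2 HU₁

/-- The chord host loop is a regular loop. [folklore] -/
theorem isRegularLoop_chordHostLoop : IsRegularLoop (b.chordHostLoop HU hl hl2 HU₁ h₂ hP hT hf₁ hε₁ hr₁ hA₁ hB₁ hAB₁ hB₂) :=
  (flipR HU₁ h₂ hP hT hf₁ hε₁ hr₁ hA₁ hB₁ hAB₁ hB₂).isRegularLoop_curve.comp_lift (b.isLift_chordLift HU hl hl2 HU₁)

/-- The chord host loop is simple. [folklore] -/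
theorem simple_chordHostLoop : ∀ s t, b.chordHostLoop HU hl hl2 HU₁ h₂ hP hT hf₁ hε₁ hr₁ hA₁ hB₁ hAB₁ hB₂ s =
    b.chordHostLoop HU hl hl2 HU₁ h₂ hP hT hf₁ hε₁ hr₁ hA₁ hB₁ hAB₁ hB₂ t → ∃ m : ℤ, t - s = m :=
  IsRegularLoop.simple_comp_lift (b.isLift_chordLift HU hl hl2 HU₁) (flipR HU₁ h₂ hP hT hf₁ hε₁ hr₁ hA₁ hB₁ hAB₁ hB₂).simple_curve

/-- **THE CHORD HOST**: the reflected flip knot of `(b₁, b₂)` reparametrised over the circle of `b`.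
[folklore] -/
def chordHost : Knot :=
  (b.isRegularLoop_chordHostLoop HU hl hl2 HU₁ h₂ hP hT hf₁ hε₁ hr₁ hA₁ hB₁ hAB₁ hB₂).toKnot
    (b.simple_chordHostLoop HU hl hl2 HU₁ h₂ hP hT hf₁ hε₁ hr₁ hA₁ hB₁ hAB₁ hB₂)

/-- **The chord host is isotopic to the reflected flip knot.**
[cite: HirschDT1976, Ch. 8, Thm. 8.1.3 (p. 180) and proof of Thm. 8.3.3 (p. 186)] -/
theorem isIsotopic_chordHost_flipR :
    (b.chordHost HU hl hl2 HU₁ h₂ hP hT hf₁ hε₁ hr₁ hA₁ hB₁ hAB₁ hB₂).IsIsotopic (flipR HU₁ h₂ hP hT hf₁ hε₁ hr₁ hA₁ hB₁ hAB₁ hB₂) := by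
  have h := (flipR HU₁ h₂ hP hT hf₁ hε₁ hr₁ hA₁ hB₁ hAB₁ hB₂).isRegularLoop_curve.isIsotopic_toKnot_comp_lift
    (b.isLift_chordLift HU hl hl2 HU₁) (flipR HU₁ h₂ hP hT hf₁ hε₁ hr₁ hA₁ hB₁ hAB₁ hB₂).simple_curve
  rw [Knot.toKnot_curve] at h
  exact h

/-- **THE CHORD HOST IS ISOTOPIC TO `R ∘ B₁`.** [cite: HirschDT1976, Ch. 8 §1, Thm. 1.3] -/
theorem isIsotopic_chordHost (hBA : B₁ = A₂.map (reflectLastDiffeo 3)) :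
    (b.chordHost HU hl hl2 HU₁ h₂ hP hT hf₁ hε₁ hr₁ hA₁ hB₁ hAB₁ hB₂).IsIsotopic (B₁.map (reflectLastDiffeo 3)) :=
  IsAmbientIsotopic.trans_holds (b.isIsotopic_chordHost_flipR HU hl hl2 HU₁ h₂ hP hT hf₁ hε₁ hr₁ hA₁ hB₁ hAB₁ hB₂)
    (isIsotopic_flipR HU₁ h₂ hP hT hf₁ hε₁ hr₁ hA₁ hB₁ hAB₁ hB₂ hBA)

/-- The chord host through `circlePt t` is the chord host loop at `t`. [folklore] -/
theorem coe_chordHost_circlePt (t : ℝ) :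
    ((b.chordHost HU hl hl2 HU₁ h₂ hP hT hf₁ hε₁ hr₁ hA₁ hB₁ hAB₁ hB₂ (circlePt t) : 𝕊 3) : 𝔼 4) =
      Knot.curve (flipR HU₁ h₂ hP hT hf₁ hε₁ hr₁ hA₁ hB₁ hAB₁ hB₂) (b.chordLift HU hl hl2 HU₁ t) :=
  (b.isRegularLoop_chordHostLoop HU hl hl2 HU₁ h₂ hP hT hf₁ hε₁ hr₁ hA₁ hB₁ hAB₁ hB₂).coe_toKnot_circlePt _ t

/-- The chord host at a parameter is the reflected flip knot at the lifted parameter. [folklore] -/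
theorem chordHost_circlePt (t : ℝ) :
    b.chordHost HU hl hl2 HU₁ h₂ hP hT hf₁ hε₁ hr₁ hA₁ hB₁ hAB₁ hB₂ (circlePt t) =
      reflectLast 3 (flipKnot h₂ hT HU₁.cone hf₁ hε₁ hr₁ hA₁ hB₁ hAB₁ hB₂ (u := 1) ⟨zero_le_one, le_rfl⟩
        (circlePt (b.chordLift HU hl hl2 HU₁ t))) := by
  apply Subtype.ext
  rw [b.coe_chordHost_circlePt, Knot.curve_apply, flipR, SphereEmbedding.map_apply, coe_reflectLastDiffeo]

include hl in
/-- **THE CHORD HOST ON THE STRAIGHT PARAMETERS OF `b` IS THE CHORD OF `b₂` WITH THE CLOCK OF `b`**: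
`chordHost (circlePt u) = ψ⁻¹ (o' + r u • d')`. [folklore] -/
theorem chordHost_circlePt_of_mem {u : ℝ} (hu : u ∈ Icc (b.strLo HU) (b.strHi HU)) :
    b.chordHost HU hl hl2 HU₁ h₂ hP hT hf₁ hε₁ hr₁ hA₁ hB₁ hAB₁ hB₂ (circlePt u) =
      psiN.symm (chordO h₂ + b.clockFn HU hl hl2 u • chordD h₂) := by
  have h1 := HU₁.cone.spike
  obtain ⟨m1, m2, m3, m3', m4, m5⟩ := b.str_marks HU hl
  have hcm := b₁.core_marks
  have hz : u ∈ Ioo (b.zoneLo HU) (b.zoneHi HU) := ⟨by linarith [hu.1], by linarith [hu.2]⟩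
  obtain ⟨-, hcore, hlev⟩ := b.chordPar_zone HU hl hl2 HU₁ hz
  have hcv := b.clockFn_str HU hl hl2 hu
  have hεL := b₁.epsLo_bounds.1
  have hεH := b₁.epsHi_bounds.1
  rw [b.chordHost_circlePt, b.chordLift_of_mem HU hl hl2 HU₁ hu]
  set s := b.chordPar HU hl hl2 HU₁ u with hs
  have hsI : s ∈ Ico b₁.alo (b₁.alo + 1) := ⟨by linarith [hcore.1], by linarith [hcore.2]⟩
  have hval : ((flipKnot h₂ hT HU₁.cone hf₁ hε₁ hr₁ hA₁ hB₁ hAB₁ hB₂ (u := 1) ⟨zero_le_one, le_rfl⟩ (circlePt s) : 𝕊 3) : 𝔼 4) =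
      ((reflectLast 3 (psiN.symm (b₂.chordLine κ₁ (-b₁.alphaHi κ₁ s))) : 𝕊 3) : 𝔼 4) := by
    rw [coe_flipKnot_circlePt, periodise_eq_self _ _ hsI]
    exact flipSpikedC_one_chord h₂ HU₁.cone hcore (by rw [hlev]; simp only [chordLev]; constructor <;> linarith [hcv.1, hcv.2])
  rw [Subtype.ext hval, reflectLast_reflectLast, hlev, chordLev, neg_neg, chordLine_chordLev]

/-- **The chord direction is nonzero** (two distinct points of the lower neck line of `b₂`). [folklore] -/
theorem chordD_ne_zero (hinj : b₂.railLoPsi κ₁ (11 / 4) ≠ b₂.railLoPsi κ₁ (5 / 4)) : chordD h₂ ≠ 0 := by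
  simp only [chordD]
  exact smul_ne_zero (by norm_num) (sub_ne_zero.2 hinj)

end Chord

end BandData

end Literature.Topology.FourManifolds
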